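import Summits.AnomalousDissipation.AnomalousDissipation.Theses.RootDecompCycle1

/-!
# Glue of the load-bearing trim of `RootDecompCycle1.RestMeanCeilingTG` (stmt-AnomalousDissipation-24256)

Sorry-free proof of the GLUE item `RootDecompCycle1.LoudQuietCeilingGlue` (stmt-AnomalousDissipation-33851):
`LoudRestMeanCeilingTG → QuietRestMeanCeilingTG → RestMeanCeilingTG` — regime cut of the rest-mean energy ceiling at a free
loudness threshold `ε` (take the quiet half's `ε`, `E := max E₁ E₂`, `ν₀ := min ν₁ ν₂`, and split on `ε ≤ meanDissipation`);
plus the two kernel necessities and the EXACTNESS `RestMeanCeilingTG ↔ Loud ∧ Quiet` (E13 type-(i) cut).  Pure logic; no facts asserted.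
Source: decomp-ad cell, lens-1 g16 node «LoadBearingTrim» (kernel `run/shared/lean/pub/decomp-ad/decomp-ad-lens-1/g16/LoadBearingTrim.lean`,
theorem `restMeanCeilingTG_iff`); landed by the cell's prover seat.  Nothing here proves the summit.
-/

set_option linter.dupNamespace false

namespace Summit.AnomalousDissipation.AnomalousDissipation.Theorems.LoadBearingTrimGlue

open Summit.AnomalousDissipation.AnomalousDissipation.Theses
open Summit.AnomalousDissipation.AnomalousDissipation.Theses.RootDecompCycle1

/-- Kernel necessity: the full ceiling implies its loud half. [folklore] -/
theorem loudRestMeanCeilingTG_of (hC : RestMeanCeilingTG) : LoudRestMeanCeilingTG := by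
  intro f hf ε _
  obtain ⟨E, ν₀, hν₀, hC'⟩ := hC f hf
  exact ⟨E, ν₀, hν₀, fun ν hν hνlt u hu _ => hC' ν hν hνlt u hu⟩

/-- Kernel necessity: the full ceiling implies its quiet half (ε := 1). [folklore] -/
theorem quietRestMeanCeilingTG_of (hC : RestMeanCeilingTG) : QuietRestMeanCeilingTG := by
  intro f hf
  obtain ⟨E, ν₀, hν₀, hC'⟩ := hC f hf
  exact ⟨1, E, ν₀, one_pos, hν₀, fun ν hν hνlt u hu _ => hC' ν hν hνlt u hu⟩

/-- EXACTNESS of the load-bearing trim: `RestMeanCeilingTG ↔ LoudRestMeanCeilingTG ∧ QuietRestMeanCeilingTG`. [folklore] -/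
theorem restMeanCeilingTG_iff :
    RestMeanCeilingTG ↔ LoudRestMeanCeilingTG ∧ QuietRestMeanCeilingTG := by
  refine ⟨fun hC => ⟨loudRestMeanCeilingTG_of hC, quietRestMeanCeilingTG_of hC⟩, ?_⟩
  rintro ⟨hL, hQ⟩ f hf
  obtain ⟨ε, E₁, ν₁, hε, hν₁, hQ'⟩ := hQ f hf
  obtain ⟨E₂, ν₂, hν₂, hL'⟩ := hL f hf ε hε
  refine ⟨max E₁ E₂, min ν₁ ν₂, lt_min hν₁ hν₂, fun ν hν hνlt u hu => ?_⟩
  by_cases h : ε ≤ Literature.Analysis.FluidPDE.meanDissipation ν u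
  · exact (hL' ν hν (lt_of_lt_of_le hνlt (min_le_right _ _)) u hu h).trans (le_max_right _ _)
  · exact (hQ' ν hν (lt_of_lt_of_le hνlt (min_le_left _ _)) u hu (lt_of_not_ge h)).trans
      (le_max_left _ _)

/-- GLUE item 33851 `LoudQuietCeilingGlue` by name. [folklore] -/
theorem loudQuietCeilingGlue_holds : LoudQuietCeilingGlue :=
  fun hL hQ => restMeanCeilingTG_iff.mpr ⟨hL, hQ⟩

end Summit.AnomalousDissipation.AnomalousDissipation.Theorems.LoadBearingTrimGlue
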